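import Literature.Computability.QuantumComplexity.QAOALevelOneMaxCut
import HarnessLib

/-!
# QAOA statistics are invariants of graph isomorphism (relabelling the register)

Topic `Literature/Computability/QuantumComplexity` (pub-qadeq lane); companion to
`QAOALevelOneMaxCut.lean`. `QAOAClassicalSymmetries.lean` treats AUTOMORPHISMS of one graph on one
register (Shaydulin–Hadfield–Hogg–Safro, Theorem 1 / Corollary 2: “graph automorphisms 𝒜_G ⊆ Aut(G)”
are symmetries of the “label-independent” MaxCut objective). Here the vertex TYPE changes: an
isomorphism `φ : G ≃g G'` between graphs on registers `V` and `V'` transports the whole level-`p`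
QAOA — circuit, state, outcome distribution, every edge term, `F_p` and `M_p`. This is the
label-independence used implicitly whenever QAOA values are attached to an isomorphism TYPE of
(sub)graph, as in Farhi–Goldstone–Gutmann's decomposition `F_p = Σ_g w_g f_g` (24) over “subgraph
types” `g` (with `QAOASubregister.lean`, which puts each term on a sub-register, it makes `f_g` a
function of the type only).

HONEST FRAMING: instance-level adjudication of specific advantage claims; no claim about BQP vs
BPP or the summit. Elementary bookkeeping; nothing about any device.

## Sources (held text, read at the cited places)

* [ShaydulinHadfieldHoggSafro2021] R. Shaydulin, S. Hadfield, T. Hogg, I. Safro, *Classical symmetries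
  and the Quantum Approximate Optimization Algorithm*, Quantum Inf. Process. 20, 359 (2021) =
  arXiv:2012.04713, §3 (p0006–p0007): objective functions “invariant under the action of a group of
  permutations of the variables”, Cor. 2 (graph automorphisms and the “label-independent” objective).
* [FarhiGoldstoneGutmann2014] E. Farhi, J. Goldstone, S. Gutmann, arXiv:1411.4028, §3 eq. (24)
  (p0005): “F_p(γ,β) = Σ_g w_g f_g(γ,β) where the sum is over all subgraph types”.

## What is formalised

For `e : V ≃ V'`: `cfg e : (V' → Bool) ≃ (V → Bool)` (relabelled bit strings) and
`transport e M = M.submatrix (cfg e) (cfg e)` (relabelled operators); for an isomorphism `φ : G ≃g G'`: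
`cutValue_iso` (`C_{G'}(x') = C_G(x' ∘ φ)`), `transport_costUnitary`, `transport_mixUnitary`,
`transport_initialState`, `transport_edgeTerm`, **`transport_qaoaUnitaryP`** (`U_p(G') = U_p(G)`
relabelled), hence **`edgeExpectP_iso`** (`⟨C_⟨φa φb⟩⟩_p^{G'} = ⟨C_⟨ab⟩⟩_p^{G}`), **`levelP_iso`**
(`F_p(G') = F_p(G)`), **`outcomeProb_iso`** (`Prob_p^{G'}(x ∘ φ⁻¹) = Prob_p^{G}(x)`), `meanCut_iso`,
**`maxLevel_iso`** (`M_p(G') = M_p(G)`).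

0 named facts, 0 sorry.
-/

noncomputable section

open Matrix Finset

namespace Literature.Computability.QuantumComplexity

namespace QAOA

variable {V V' : Type*} [Fintype V] [DecidableEq V] [Fintype V'] [DecidableEq V']

/-! ### Relabelling bit strings and operators along `e : V ≃ V'` -/

/-- Bit strings on `V'` read through `e`: `x' ↦ x' ∘ e`. [folklore] -/
def cfg (e : V ≃ V') : (V' → Bool) ≃ (V → Bool) where
  toFun x' := fun i => x' (e i)
  invFun x := fun i' => x (e.symm i')
  left_inv x' := by funext i'; simp
  right_inv x := by funext i; simp

omit [Fintype V] [DecidableEq V] [Fintype V'] [DecidableEq V'] in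
/-- Unfolding of `cfg`. [folklore] -/
private theorem cfg_apply (e : V ≃ V') (x' : V' → Bool) (i : V) : cfg e x' i = x' (e i) := rfl

omit [Fintype V] [DecidableEq V] [Fintype V'] [DecidableEq V'] in
/-- Unfolding of `cfg⁻¹`. [folklore] -/
private theorem cfg_symm_apply (e : V ≃ V') (x : V → Bool) (i' : V') : (cfg e).symm x i' = x (e.symm i') := rfl

/-- An operator on the register `V → Bool`, relabelled to `V' → Bool` (SHHS's “permutations of the
variables”). [cite: ShaydulinHadfieldHoggSafro2021, §3 (“a group of permutations of the variables”)] -/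
def transport (e : V ≃ V') (M : Matrix (V → Bool) (V → Bool) ℂ) : Matrix (V' → Bool) (V' → Bool) ℂ :=
  M.submatrix (cfg e) (cfg e)

/-- Relabelling is multiplicative. [folklore] -/
private theorem transport_mul (e : V ≃ V') (M N : Matrix (V → Bool) (V → Bool) ℂ) :
    transport e (M * N) = transport e M * transport e N := by
  rw [transport, transport, transport, submatrix_mul_equiv]

omit [DecidableEq V] [DecidableEq V'] in
/-- Relabelling the identity. [folklore] -/
private theorem transport_one (e : V ≃ V') : transport e (1 : Matrix (V → Bool) (V → Bool) ℂ) = 1 := by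
  rw [transport, submatrix_one_equiv]

omit [Fintype V] [DecidableEq V] [Fintype V'] [DecidableEq V'] in
/-- Relabelling commutes with the adjoint. [folklore] -/
private theorem transport_conjTranspose (e : V ≃ V') (M : Matrix (V → Bool) (V → Bool) ℂ) :
    (transport e M)ᴴ = transport e Mᴴ := by
  rw [transport, transport, conjTranspose_submatrix]

/-- Relabelling preserves the trace. [folklore] -/
private theorem trace_transport (e : V ≃ V') (M : Matrix (V → Bool) (V → Bool) ℂ) :
    (transport e M).trace = M.trace := by
  rw [transport, Matrix.trace, Matrix.trace]
  simp only [diag_apply, submatrix_apply]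
  exact Equiv.sum_comp (cfg e) (fun z => M z z)

omit [DecidableEq V] [DecidableEq V'] in
/-- Relabelling a tensor-product operator relabels its factors. [folklore] -/
private theorem transport_tensorAll (e : V ≃ V') (g : V → Matrix Bool Bool ℂ) :
    transport e (tensorAll g) = tensorAll fun i' => g (e.symm i') := by
  ext x' y'
  rw [transport, submatrix_apply, tensorAll_apply, tensorAll_apply]
  simp only [cfg_apply]
  exact (Equiv.prod_comp e.symm (fun i => g i (x' (e i)) (y' (e i)))).symm.trans
    (Fintype.prod_congr _ _ fun i' => by simp)

omit [DecidableEq V] [DecidableEq V'] in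
/-- Relabelling a diagonal operator. [folklore] -/
private theorem transport_diagonal (e : V ≃ V') (d : (V → Bool) → ℂ) :
    transport e (diagonal d) = diagonal fun x' => d (cfg e x') := by
  rw [transport, submatrix_diagonal_equiv]
  rfl

omit [DecidableEq V] [DecidableEq V'] in
/-- `U(B, β)` is relabelling-invariant. [cite: ShaydulinHadfieldHoggSafro2021, Cor. 1 (qubit
permutations “permute the terms” of B)] -/
theorem transport_mixUnitary (e : V ≃ V') (β : ℝ) :
    transport e (mixUnitary β : Matrix (V → Bool) (V → Bool) ℂ) = mixUnitary β := by
  rw [mixUnitary, transport_tensorAll]; rfl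

omit [DecidableEq V] [DecidableEq V'] in
/-- `ρ₀ = |s⟩⟨s|` is relabelling-invariant. [cite: ShaydulinHadfieldHoggSafro2021, Lemma 1 (A|s⟩ =
|s⟩)] -/
theorem transport_initialState (e : V ≃ V') :
    transport e (initialState : Matrix (V → Bool) (V → Bool) ℂ) = initialState := by
  rw [initialState, transport_tensorAll]; rfl

/-! ### Along a graph isomorphism `φ : G ≃g G'` -/

variable (G : SimpleGraph V) [DecidableRel G.Adj] (G' : SimpleGraph V') [DecidableRel G'.Adj]

omit [Fintype V] [DecidableEq V] [Fintype V'] [DecidableEq V'] in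
/-- Relabelled cut indicators. [folklore] -/
private theorem cutInd_cfg (e : V ≃ V') (x' : V' → Bool) (s : Sym2 V) :
    cutInd (cfg e x') s = cutInd x' (s.map e) := by
  induction s using Sym2.ind with
  | h a b => rw [Sym2.map_mk, cutInd_mk, cutInd_mk]; rfl

omit [DecidableEq V] [DecidableEq V'] in
/-- **The MaxCut objective is label-independent:** `C_{G'}(x') = C_G(x' ∘ φ)` for an isomorphism
`φ : G ≃g G'`. [cite: ShaydulinHadfieldHoggSafro2021, Cor. 2 (automorphisms of a “label-independent”
objective)] -/
theorem cutValue_iso (φ : G ≃g G') (x' : V' → Bool) : cutValue G (cfg φ.toEquiv x') = cutValue G' x' := by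
  rw [cutValue, cutValue]
  simp_rw [cutInd_cfg]
  refine Finset.sum_nbij' (fun s => s.map φ.toEquiv) (fun s => s.map φ.symm.toEquiv) ?_ ?_ ?_ ?_ ?_
  · intro s hs
    rw [SimpleGraph.mem_edgeFinset] at hs ⊢
    exact (SimpleGraph.Iso.map_mem_edgeSet_iff φ).2 hs
  · intro s hs
    rw [SimpleGraph.mem_edgeFinset] at hs ⊢
    exact (SimpleGraph.Iso.map_mem_edgeSet_iff φ.symm).2 hs
  · intro s _
    induction s using Sym2.ind with
    | h u v => simp
  · intro s _
    induction s using Sym2.ind with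
    | h u v => simp
  · intro s _; rfl

omit [DecidableEq V] [DecidableEq V'] in
/-- `U(C_{G'}, γ)` is `U(C_G, γ)` relabelled. [cite: ShaydulinHadfieldHoggSafro2021, Thm. 1 (i′)
(c(a(x)) = c(x) ⇒ A commutes with C)] -/
theorem transport_costUnitary (φ : G ≃g G') (γ : ℝ) :
    transport φ.toEquiv (costUnitary G γ) = costUnitary G' γ := by
  rw [costUnitary, costUnitary, transport_diagonal]
  congr 1
  funext x'
  rw [cutValue_iso G G' φ]

/-- An edge term relabelled is the edge term of the image edge. [cite: ShaydulinHadfieldHoggSafro2021,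
Cor. 2] -/
theorem transport_edgeTerm (e : V ≃ V') (a b : V) :
    transport e (edgeTerm s(a, b) : Matrix (V → Bool) (V → Bool) ℂ) = edgeTerm s(e a, e b) := by
  rw [edgeTerm_eq_diagonal, edgeTerm_eq_diagonal, transport_diagonal]
  rfl

/-- **The level-`p` circuit of `G'` is the level-`p` circuit of `G`, relabelled.** [cite:
ShaydulinHadfieldHoggSafro2021, Lemma 1 / Thm. 1 (symmetries commute with every layer)] -/
theorem transport_qaoaUnitaryP (φ : G ≃g G') (p : ℕ) :
    ∀ γ β : Fin p → ℝ, transport φ.toEquiv (qaoaUnitaryP G p γ β) = qaoaUnitaryP G' p γ β := by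
  induction p with
  | zero => intro γ β; rw [qaoaUnitaryP, qaoaUnitaryP, transport_one]
  | succ p ih =>
    intro γ β
    rw [qaoaUnitaryP, qaoaUnitaryP, transport_mul, transport_mul, transport_mixUnitary,
      transport_costUnitary G G' φ, ih]

/-- **Edge expectations are isomorphism invariants:** `⟨γ,β|C_⟨φa φb⟩|γ,β⟩_{G'} = ⟨γ,β|C_⟨ab⟩|γ,β⟩_G`.
[cite: ShaydulinHadfieldHoggSafro2021, Cor. 2] [cite: FarhiGoldstoneGutmann2014, §3 eq. (24) (f_g is
attached to the subgraph TYPE g)] -/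
theorem edgeExpectP_iso (φ : G ≃g G') (p : ℕ) (γ β : Fin p → ℝ) (a b : V) :
    edgeExpectP G' p γ β s(φ a, φ b) = edgeExpectP G p γ β s(a, b) := by
  rw [edgeExpectP, edgeExpectP, finalStateP, finalStateP, ← transport_qaoaUnitaryP G G' φ,
    ← transport_initialState φ.toEquiv, transport_conjTranspose,
    show s(φ a, φ b) = s(φ.toEquiv a, φ.toEquiv b) from rfl, ← transport_edgeTerm,
    ← transport_mul, ← transport_mul, ← transport_mul, trace_transport]

/-- **`F_p` is an isomorphism invariant: `F_p(G') = F_p(G)`.** [cite: ShaydulinHadfieldHoggSafro2021,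
Cor. 2 (“label-independent objective function”)] -/
theorem levelP_iso (φ : G ≃g G') (p : ℕ) (γ β : Fin p → ℝ) : levelP G' p γ β = levelP G p γ β := by
  rw [levelP_eq_sum_edgeExpectP, levelP_eq_sum_edgeExpectP]
  refine (Finset.sum_nbij' (fun s => s.map φ.toEquiv) (fun s => s.map φ.symm.toEquiv) ?_ ?_ ?_ ?_ ?_).symm
  · intro s hs
    rw [SimpleGraph.mem_edgeFinset] at hs ⊢
    exact (SimpleGraph.Iso.map_mem_edgeSet_iff φ).2 hs
  · intro s hs
    rw [SimpleGraph.mem_edgeFinset] at hs ⊢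
    exact (SimpleGraph.Iso.map_mem_edgeSet_iff φ.symm).2 hs
  · intro s _
    induction s using Sym2.ind with
    | h u v => simp
  · intro s _
    induction s using Sym2.ind with
    | h u v => simp
  · intro s _
    induction s using Sym2.ind with
    | h a b => rw [Sym2.map_mk]; exact (edgeExpectP_iso G G' φ p γ β a b).symm

omit [DecidableEq V] [DecidableEq V'] in
/-- `|s⟩` has the same amplitudes on isomorphic registers. [folklore] -/
private theorem plusState_cfg (e : V ≃ V') (x' : V' → Bool) :
    (plusState : (V → Bool) → ℂ) (cfg e x') = (plusState : (V' → Bool) → ℂ) x' := by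
  simp only [plusState, Fintype.card_congr e]

/-- **The outcome distribution is an isomorphism invariant:** `Prob_p^{G'}(x') = Prob_p^{G}(x' ∘ φ)`.
[cite: ShaydulinHadfieldHoggSafro2021, Thm. 1 / Cor. 2 (probabilities “connected by a symmetry” are
equal)] -/
theorem outcomeProb_iso (φ : G ≃g G') (p : ℕ) (γ β : Fin p → ℝ) (x' : V' → Bool) :
    outcomeProb G' p γ β x' = outcomeProb G p γ β (cfg φ.toEquiv x') := by
  unfold outcomeProb qaoaStateP
  rw [← transport_qaoaUnitaryP G G' φ, transport, submatrix_mulVec_equiv]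
  have h : ((plusState : (V' → Bool) → ℂ) ∘ (cfg φ.toEquiv).symm) = (plusState : (V → Bool) → ℂ) := by
    funext x
    rw [Function.comp_apply, ← plusState_cfg φ.toEquiv ((cfg φ.toEquiv).symm x), Equiv.apply_symm_apply]
  rw [h, Function.comp_apply]

/-- **`F_p` as the mean measured cut is an isomorphism invariant.** [cite:
ShaydulinHadfieldHoggSafro2021, Cor. 2] -/
theorem meanCut_iso (φ : G ≃g G') (p : ℕ) (γ β : Fin p → ℝ) : meanCut G' p γ β = meanCut G p γ β := by
  have h := levelP_iso G G' φ p γ β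
  rw [levelP_eq_meanCut, levelP_eq_meanCut] at h
  exact_mod_cast h

/-- **`M_p` is an isomorphism invariant: `M_p(G') = M_p(G)`.** [cite: ShaydulinHadfieldHoggSafro2021,
Cor. 2] [cite: FarhiGoldstoneGutmann2014, eq. (8)] -/
theorem maxLevel_iso (φ : G ≃g G') (p : ℕ) : maxLevel G' p = maxLevel G p := by
  unfold maxLevel
  exact iSup_congr fun a => meanCut_iso G G' φ p a.1 a.2

end QAOA

end Literature.Computability.QuantumComplexity
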